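import Literature.Analysis.Asymptotics.UniformQuadraticTiltExpansion
import Literature.Probability.Moments.FiniteTiltModerateDeviations
import Literature.Probability.Moments.MGFContinuityTheorem
import HarnessLib

/-!
# The central limit theorem of a finitely supported statistic from a uniform quadratic expansion of its log-Laplace transform

Model-free companion of `Literature/Probability/Moments/FiniteTiltModerateDeviations.lean` (UQE ⇒ moderate deviations) and
`Literature/Analysis/Asymptotics/UniformQuadraticTiltExpansion.lean` (uniform two-term asymptotics + `C²` free energy ⇒ UQE; `tendsto_of_uqe`).
For a finite family of nonnegative weights `w_n` on `S_n` with statistic `X_n`, scale `a_n → ∞`, centring `c_n` and curvature `H`, the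
UNIFORM QUADRATIC EXPANSION

  `∀ η > 0 ∃ δ > 0`, eventually `∀ |s| ≤ δ a_n`: `|log (Σ w e^{(s/a_n)X}/Σ w) − s c_n/a_n − H s²/2| ≤ η s² + η`

gives (§1, ★★ `tendsto_tiltRatio_of_uqe`) the Gaussian limit of the moment generating function of `(X_n − c_n)/a_n` under `P_n = w_n/Z_n`:
`Σ w e^{(s/a_n)(X − c_n)}/Σ w → e^{H s²/2}` for EVERY real `s`; hence (§2, ★★★ `tendsto_gaussianReal_of_uqe`, via Curtiss' continuity theorem
`tendsto_gaussianReal_of_tendsto_mgf` of `MGFContinuityTheorem.lean`) every sequence of probability measures `μ_n` on `ℝ` whose mgf is that tilt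
ratio converges WEAKLY to `N(0, H)`, with convergence of the distribution functions at every point when `H ≠ 0`
(`tendsto_measureReal_Iic_of_uqe`).  With `FiniteTiltModerateDeviations` this closes the circle: ONE analytic input (UQE) ⇒ CLT + MDP.

## Sources
J. H. Curtiss, Ann. Math. Statist. 13 (1942) Theorem 3 (mgf continuity theorem); A. Dembo, O. Zeitouni (2010) §2.3 (lane statements); R. Durrett,
*Probability: Theory and Examples* (2019) §3.4.  The packaging is this lineage's (lane «pcv-sawmu», a-p5 g27); nothing is quoted AS PRINTED.
-/

noncomputable section

open MeasureTheory ProbabilityTheory Filter Set Finset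
open Literature.Analysis.Asymptotics
open scoped Topology

namespace Literature.Probability.Moments

/-! ## §1 ★★ The Gaussian limit of the tilt ratio -/

section Ratio

variable {α ι : Type*} {l : Filter α} (S : α → Finset ι) (w X : α → ι → ℝ) (a c : α → ℝ) (H : ℝ)

open Classical in
/-- ★★ **THE GAUSSIAN LIMIT OF THE MOMENT GENERATING FUNCTION FROM A UQE.**  Under the uniform quadratic expansion with curvature `H` (nonnegative
weights of positive mass, scale `a_n → ∞`), for every real `s`:
`(Σ_i w_n(i) e^{(s/a_n) X_n(i)} / Σ_i w_n(i)) · e^{−s c_n/a_n} → e^{H s²/2}` — the mgf of `(X_n − c_n)/a_n` under `P_n` converges to the mgf of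
`N(0, H)`. [cite: DemboZeitouni2010, §2.3 (lane statement); Curtiss1942, Theorem 3] -/
theorem tendsto_tiltRatio_of_uqe (hw : ∀ᶠ n in l, ∀ i ∈ S n, 0 ≤ w n i) (hZ : ∀ᶠ n in l, 0 < ∑ i ∈ S n, w n i)
    (ha : Tendsto a l atTop)
    (hU : ∀ η : ℝ, 0 < η → ∃ δ : ℝ, 0 < δ ∧ ∀ᶠ n in l, ∀ s : ℝ, |s| ≤ δ * a n →
      |Real.log ((∑ i ∈ S n, w n i * Real.exp (s / a n * X n i)) / ∑ i ∈ S n, w n i) - s * c n / a n - H * s ^ 2 / 2| ≤ η * s ^ 2 + η)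
    (s : ℝ) :
    Tendsto (fun n => (∑ i ∈ S n, w n i * Real.exp (s / a n * X n i)) / (∑ i ∈ S n, w n i) * Real.exp (-(s * c n / a n))) l
      (𝓝 (Real.exp (H * s ^ 2 / 2))) := by
  -- the log of the quantity satisfies the UQE shape of `tendsto_of_uqe`
  have hlog := tendsto_of_uqe (l := l) (a := a) (H := H)
    (G := fun n s => Real.log ((∑ i ∈ S n, w n i * Real.exp (s / a n * X n i)) / ∑ i ∈ S n, w n i) - s * c n / a n) ha
    (fun η hη => by
      obtain ⟨δ, hδ, hev⟩ := hU η hη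
      exact ⟨δ, hδ, hev.mono fun n hn s hs => by simpa only [sub_sub] using hn s hs⟩) s
  have hexp := (Real.continuous_exp.tendsto _).comp hlog
  refine hexp.congr' ?_
  filter_upwards [hw, hZ] with n hwn hZn
  have hpos := tiltSum_pos_of_sum_pos (X n) hwn hZn (s / a n)
  simp only [Function.comp_apply]
  rw [Real.exp_sub, Real.exp_log (div_pos hpos hZn), Real.exp_neg, div_eq_mul_inv]

end Ratio

/-! ## §2 ★★★ The central limit theorem from a UQE (Curtiss) -/

open Classical in
/-- ★★★ **THE CENTRAL LIMIT THEOREM FROM A UNIFORM QUADRATIC EXPANSION.**  Let `μ_n` (`n ∈ ℕ`) be probability measures on `ℝ` whose moment generating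
functions are the tilt ratios of a finite family: `∫ e^{sx} dμ_n = (Σ_i w_n(i) e^{(s/a_n)X_n(i)} / Σ_i w_n(i)) · e^{−s c_n/a_n}` for all real `s` (the law of
`(X_n − c_n)/a_n` under `P_n = w_n/Z_n`), with `e^{sx}` integrable.  If the family satisfies the uniform quadratic expansion with curvature `H ≥ 0`
and `a_n → ∞`, then `μ_n ⟶ N(0, H)` WEAKLY. [cite: Curtiss1942, Theorem 3 (mgf continuity theorem); DemboZeitouni2010, §2.3 (lane statement)] -/
theorem tendsto_gaussianReal_of_uqe {ι : Type*} (S : ℕ → Finset ι) (w X : ℕ → ι → ℝ) (a c : ℕ → ℝ) (H : NNReal)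
    {μ : ℕ → ProbabilityMeasure ℝ}
    (hw : ∀ᶠ n in atTop, ∀ i ∈ S n, 0 ≤ w n i) (hZ : ∀ᶠ n in atTop, 0 < ∑ i ∈ S n, w n i) (ha : Tendsto a atTop atTop)
    (hU : ∀ η : ℝ, 0 < η → ∃ δ : ℝ, 0 < δ ∧ ∀ᶠ n in atTop, ∀ s : ℝ, |s| ≤ δ * a n →
      |Real.log ((∑ i ∈ S n, w n i * Real.exp (s / a n * X n i)) / ∑ i ∈ S n, w n i) - s * c n / a n - (H : ℝ) * s ^ 2 / 2| ≤ η * s ^ 2 + η)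
    (hint : ∀ s : ℝ, ∀ n, Integrable (fun x => Real.exp (s * x)) (μ n : Measure ℝ))
    (hmgf : ∀ s : ℝ, ∀ᶠ n in atTop,
      ∫ x, Real.exp (s * x) ∂(μ n : Measure ℝ) = (∑ i ∈ S n, w n i * Real.exp (s / a n * X n i)) / (∑ i ∈ S n, w n i) * Real.exp (-(s * c n / a n))) :
    Tendsto μ atTop (𝓝 ⟨gaussianReal 0 H, inferInstance⟩) := by
  refine tendsto_gaussianReal_of_tendsto_mgf 0 H one_pos (fun s _ n => hint s n) fun s _ => ?_
  have h := tendsto_tiltRatio_of_uqe S w X a c (H : ℝ) hw hZ ha hU s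
  rw [show (0 : ℝ) * s + (H : ℝ) * s ^ 2 / 2 = (H : ℝ) * s ^ 2 / 2 by ring]
  exact h.congr' ((hmgf s).mono fun n hn => hn.symm)

open Classical in
/-- ★★★ **THE CLT FROM A UQE, DISTRIBUTION FUNCTIONS**: under the hypotheses of `tendsto_gaussianReal_of_uqe` with `H ≠ 0`,
`μ_n(−∞, x] → N(0, H)(−∞, x]` for EVERY real `x`. [cite: Curtiss1942, Theorem 3; Durrett2019, §3.2 Theorem 3.2.11 (iv) (lane statement)] -/
theorem tendsto_measureReal_Iic_of_uqe {ι : Type*} (S : ℕ → Finset ι) (w X : ℕ → ι → ℝ) (a c : ℕ → ℝ) {H : NNReal} (hH : H ≠ 0)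
    {μ : ℕ → ProbabilityMeasure ℝ}
    (hw : ∀ᶠ n in atTop, ∀ i ∈ S n, 0 ≤ w n i) (hZ : ∀ᶠ n in atTop, 0 < ∑ i ∈ S n, w n i) (ha : Tendsto a atTop atTop)
    (hU : ∀ η : ℝ, 0 < η → ∃ δ : ℝ, 0 < δ ∧ ∀ᶠ n in atTop, ∀ s : ℝ, |s| ≤ δ * a n →
      |Real.log ((∑ i ∈ S n, w n i * Real.exp (s / a n * X n i)) / ∑ i ∈ S n, w n i) - s * c n / a n - (H : ℝ) * s ^ 2 / 2| ≤ η * s ^ 2 + η)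
    (hint : ∀ s : ℝ, ∀ n, Integrable (fun x => Real.exp (s * x)) (μ n : Measure ℝ))
    (hmgf : ∀ s : ℝ, ∀ᶠ n in atTop,
      ∫ x, Real.exp (s * x) ∂(μ n : Measure ℝ) = (∑ i ∈ S n, w n i * Real.exp (s / a n * X n i)) / (∑ i ∈ S n, w n i) * Real.exp (-(s * c n / a n)))
    (x : ℝ) :
    Tendsto (fun n => (μ n : Measure ℝ).real (Iic x)) atTop (𝓝 ((gaussianReal 0 H).real (Iic x))) :=
  @tendsto_measureReal_Iic_of_tendsto μ ⟨gaussianReal 0 H, inferInstance⟩ (nullSingletonClass_gaussianReal hH)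
    (tendsto_gaussianReal_of_uqe S w X a c H hw hZ ha hU hint hmgf) x

end Literature.Probability.Moments

end
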